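import Summits.ValiantsHypothesis.ValiantsHypothesis.Theorems.BarrierLeverDefinableEquationsProductDepthSlice

/-!
# Route BarrierLever — the MODEL axis of crux `DefinableEquations` (stmt-8745) / item
# `SingleSizeEquations` (stmt-8749): the constant-product-depth slice at LEVEL ONE, uniformly in the
# size exponent (the `∃ a ∀ b` quantifier shape of the crux; val-np-p5 g9)

`LSTSlice.naturalProofsAgainstProductDepth` (val-np-p5 g8) gives, for every size exponent `b` and
product-depth `Δ ≥ 1`, a level `a = 7d + 10` (with `d = d(b, Δ)` the number of LST blocks) and a
threshold `n₀` such that for `n ≥ n₀` the degree-`≤ n` polynomials computed by product-depth-`Δ`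
circuits with `≤ n^b` gates are not a succinct hitting set for `Distinguishers ℂ n a`.  The level
there depends on `b` only through the crude bound `n ≤ C(2n,n)`.  Here the same distinguisher (the
coordinate determinant of a `2^{min(|σ⁺|,|σ⁻|)} ≤ 2^{d ⌊log₂ n⌋} = n^{O(d)}`-square block of the LST
coefficient matrix) is shown to have size and degree `≤ 2^n ≤ C(2n,n)` once `n ≥ 2^M + d` for the
SAME threshold `M(b, Δ)` as in g8's proof (`7 d ⌊log₂ n⌋ + 10 ≤ ⌊log₂ n⌋² + 10 ≤ 2^{⌊log₂ n⌋} ≤ n`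
because `10 d ≤ ⌊log₂ n⌋` and `⌊log₂ n⌋ ≥ 20`), so the level is `a = 1` for EVERY `b` and `Δ`:

* `naturalProofsAgainstProductDepth_levelOne` : `∀ b Δ, 1 ≤ Δ → ∃ n₀, ∀ n ≥ n₀, ¬ IsSuccinctHittingSet
  (degLEMonomials n) {deg ≤ n, product-depth-Δ circuits with ≤ n^b gates} (Distinguishers ℂ n 1)`;
* `naturalProofsAgainstProductDepth_uniform` : the `∃ a ∀ b` form (`a = 1`), i.e. the quantifier
  shape of crux `DefinableEquations` on the constant-product-depth slice, and
  `productDepthSliceEquations_uniform`, its `q = 0` Boolean-sum rendering.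

What this is NOT: the same slice as g8's file (Limaye–Srinivasan–Tavenas made FSV-natural), only
the level bookkeeping is sharpened; nothing on general size-`n^b` circuits (the crux, OPEN) or on
`VP ≠ VNP`.  No definitions, no named facts; standard axioms.
Refs: Limaye–Srinivasan–Tavenas 2025 Cor. 4; Forbes–Shpilka–Volk 2018 Def. 1/3.
-/

-- `Summit.ValiantsHypothesis.ValiantsHypothesis.…` repeats a component by the D-0017 layout
-- (single-conjunct summit), which the `dupNamespace` linter flags; the name is mandated.
set_option linter.dupNamespace false

noncomputable section

namespace Summit.ValiantsHypothesis.ValiantsHypothesis.Theorems.BarrierLeverDefinableEquations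

open MvPolynomial
open Literature.Computability.AlgebraicComplexity Literature.Barriers.ValiantsHypothesis
open Literature.Computability.AlgebraicComplexity.LSTWord
open scoped BigOperators

namespace LSTSlice

/-- `K² + 10 ≤ 2^K` for `K ≥ 6`. [folklore] -/
theorem sq_add_ten_le_two_pow {K : ℕ} (hK : 6 ≤ K) : K ^ 2 + 10 ≤ 2 ^ K := by
  induction K, hK using Nat.le_induction with
  | base => norm_num
  | succ K hK ih =>
    have h2 : 2 * K + 1 ≤ K ^ 2 + 10 := by nlinarith
    calc (K + 1) ^ 2 + 10 = K ^ 2 + 10 + (2 * K + 1) := by ring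
      _ ≤ 2 ^ K + 2 ^ K := Nat.add_le_add ih (h2.trans ih)
      _ = 2 ^ (K + 1) := by rw [pow_succ]; ring

/-- Level-one bookkeeping: if `10 d ≤ K`, `20 ≤ K` and `2^K ≤ n` then
`8 (2^{d K} + 1)^7 ≤ 2^n ≤ C(2n,n)`. [folklore] -/
theorem level_one_le {n d K : ℕ} (h10 : 10 * d ≤ K) (hK : 20 ≤ K) (h2K : 2 ^ K ≤ n) :
    8 * (2 ^ (d * K) + 1) ^ 7 ≤ Nat.choose (2 * n) n ^ 1 := by
  rw [pow_one]
  refine le_trans ?_ (Literature.ModelTheory.FiniteModelTheory.two_pow_le_choose_two_mul_self n)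
  have h1 : 2 ^ (d * K) + 1 ≤ 2 ^ (d * K + 1) := by
    rw [pow_succ]; have := Nat.one_le_two_pow (n := d * K); omega
  have hexp : 7 * (d * K + 1) + 3 ≤ n := by
    have hdK : 7 * (d * K) ≤ K ^ 2 := by nlinarith
    have := sq_add_ten_le_two_pow (show 6 ≤ K by omega)
    omega
  calc 8 * (2 ^ (d * K) + 1) ^ 7 ≤ 8 * (2 ^ (d * K + 1)) ^ 7 := by gcongr
    _ = 2 ^ (7 * (d * K + 1) + 3) := by rw [← pow_mul, pow_add 2 (7 * (d * K + 1)) 3]; ring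
    _ ≤ 2 ^ n := Nat.pow_le_pow_right (by norm_num) hexp

/-- **NATURAL PROOFS AGAINST CONSTANT PRODUCT-DEPTH CIRCUITS OF EVERY POLYNOMIAL SIZE, AT LEVEL
ONE.**  For every size exponent `b` and product-depth `Δ ≥ 1` there is `n₀` such that for all
`n ≥ n₀` the `n`-variate polynomials of degree `≤ n` computed by arithmetic circuits (unbounded
fan-in) with `≤ n^b` gates and product-depth `≤ Δ` are NOT a succinct hitting set for
`Distinguishers ℂ n 1`: the LST coordinate determinant of g8's proof has size and degree
`≤ 2^n ≤ C(2n,n)`.  Same proof as `naturalProofsAgainstProductDepth` with the level bookkeeping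
`level_one_le`. [cite: LimayeSrinivasanTavenas2025, Cor. 4] -/
theorem naturalProofsAgainstProductDepth_levelOne (b Δ : ℕ) (hΔ : 1 ≤ Δ) :
    ∃ n₀ : ℕ, ∀ n ≥ n₀, ¬ IsSuccinctHittingSet (degLEMonomials n)
      {f : MvPolynomial (Fin n) ℂ | f.totalDegree ≤ n ∧
        ∃ P : ArithCircuit ℂ (Fin n), P.Computes f ∧ P.size ≤ n ^ b ∧ P.productDepth ≤ Δ}
      (Distinguishers ℂ n 1) := by
  -- adapted from `naturalProofsAgainstProductDepth` (val-np-p5 g8): only `ha` changes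
  obtain ⟨δ, hδ, ε, hε, -, d₀, hd₀, H⟩ := final_arith (Δ := Δ) hΔ
  obtain ⟨d, hd₀d, hbδ⟩ : ∃ d : ℕ, d₀ ≤ d ∧ (b : ℝ) + 1 ≤ (d : ℝ) ^ δ :=
    ⟨max d₀ ⌈((b : ℝ) + 1) ^ (1 / δ)⌉₊, le_max_left _ _,
      rpow_ge_of_ceil_le hδ (le_max_right _ _)⟩
  have hd1 : 1 ≤ d := hd₀.trans hd₀d
  obtain ⟨c, hdc⟩ : ∃ c : ℕ, d < 2 ^ c := ⟨Nat.log 2 d + 1, Nat.lt_pow_succ_log_self one_lt_two d⟩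
  set M : ℕ := ⌈(d : ℝ) / ε⌉₊ + 10 * d + 6 * c + 10 with hM
  refine ⟨2 ^ M + d, fun n hn => ?_⟩
  have hnM : 2 ^ M ≤ n := le_trans (Nat.le_add_right _ _) hn
  have hdn : d ≤ n := le_trans (Nat.le_add_left _ _) hn
  have hn1 : 1 ≤ n := hd1.trans hdn
  have hMpos : 1 ≤ M := by omega
  have hn2 : 2 ≤ n := le_trans (by
    calc (2 : ℕ) = 2 ^ 1 := by norm_num
      _ ≤ 2 ^ M := Nat.pow_le_pow_right (by norm_num) hMpos) hnM
  set K := Nat.log 2 n with hK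
  have hMK : M ≤ K := Nat.le_log_of_pow_le one_lt_two hnM
  have h2K : 2 ^ K ≤ n := Nat.pow_log_le_self 2 (by omega)
  have hn2K : n < 2 ^ (K + 1) := Nat.lt_pow_succ_log_self one_lt_two n
  obtain ⟨k, hkK⟩ : ∃ k, K = k + c := ⟨K - c, by omega⟩
  have hceil : ⌈(d : ℝ) / ε⌉₊ ≤ k := by omega
  have h10 : 10 * d ≤ k := by omega
  have hk1 : 1 ≤ k := by omega
  set pos := greedyWord d k with hpos
  have hover : overLen k pos d ≤ k := by
    rw [overLen_eq_natAbs k pos d le_rfl]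
    have h := abs_prefixSum_greedyWord_le d k d le_rfl
    rw [← hpos, abs_le] at h
    omega
  have hcardle : Fintype.card (Σ i : Fin d, BlockVar k pos i) ≤ n := by
    refine (card_blockVars_le k pos).trans ?_
    calc d * 2 ^ k ≤ 2 ^ c * 2 ^ k := Nat.mul_le_mul_right _ hdc.le
      _ = 2 ^ K := by rw [← pow_add, add_comm, hkK]
      _ ≤ n := h2K
  let e : (Σ i : Fin d, BlockVar k pos i) ↪ Fin n :=
    (Fintype.equivFin _).toEmbedding.trans (Fin.castLEEmb hcardle)
  -- the level: `8 (2^min + 1)^7 ≤ 8 (2^{d K} + 1)^7 ≤ 2^n ≤ C(2n,n)`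
  have ha : 8 * (2 ^ min (streamLen k pos true d) (streamLen k pos false d) + 1) ^ 7 ≤
      Nat.choose (2 * n) n ^ 1 := by
    refine le_trans ?_ (level_one_le (d := d) (K := K) (by omega) (by omega) h2K)
    have hmin : 2 ^ min (streamLen k pos true d) (streamLen k pos false d) ≤ 2 ^ (d * K) :=
      Nat.pow_le_pow_right (by norm_num)
        (((min_le_left _ _).trans (streamLen_le k pos true d)).trans
          (Nat.mul_le_mul_left d (by omega)))
    gcongr
  -- the numeric hypothesis, verbatim from g8's proof
  have hnR2 : (2 : ℝ) ≤ n := by exact_mod_cast hn2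
  have hnR1 : (1 : ℝ) ≤ n := by linarith
  have hkR1 : (1 : ℝ) ≤ k := by exact_mod_cast hk1
  have hnum : Lam (n ^ b) n d Δ * Phi k Δ d < (2 : ℝ) ^ (-(k : ℝ) / 2) := by
    by_contra hge
    push Not at hge
    have hdk : (d : ℝ) ≤ ε * ((k : ℝ) + 1) := by
      have h1 : (d : ℝ) / ε ≤ k := (Nat.le_ceil _).trans (by exact_mod_cast hceil)
      rw [div_le_iff₀ hε] at h1
      nlinarith
    have hN : (n : ℝ) + 1 ≤ (2 : ℝ) ^ (6 * (k : ℝ)) := by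
      have h1 : n + 1 ≤ 2 ^ (6 * k) :=
        (Nat.succ_le_of_lt hn2K).trans (Nat.pow_le_pow_right (by norm_num) (by omega))
      have h2 : ((n + 1 : ℕ) : ℝ) ≤ ((2 ^ (6 * k) : ℕ) : ℝ) := by exact_mod_cast h1
      rw [show (6 : ℝ) * (k : ℝ) = ((6 * k : ℕ) : ℝ) by push_cast; ring, Real.rpow_natCast]
      push_cast at h2 ⊢
      exact h2
    have hsqrt : Real.sqrt n ≤ (2 : ℝ) ^ (k : ℝ) := by
      have h1 : n ≤ (2 ^ k) ^ 2 := by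
        calc n ≤ 2 ^ (K + 1) := hn2K.le
          _ ≤ 2 ^ (2 * k) := Nat.pow_le_pow_right (by norm_num) (by omega)
          _ = (2 ^ k) ^ 2 := by rw [← pow_mul, mul_comm]
      have h2 : (n : ℝ) ≤ ((2 : ℝ) ^ (k : ℝ)) ^ 2 := by
        rw [Real.rpow_natCast]; exact_mod_cast h1
      calc Real.sqrt n ≤ Real.sqrt (((2 : ℝ) ^ (k : ℝ)) ^ 2) := Real.sqrt_le_sqrt h2
        _ = (2 : ℝ) ^ (k : ℝ) := Real.sqrt_sq (by positivity)
    have hfin := H n d (n ^ b) n k hd₀d hdk h10 hk1 hN hsqrt hnR2 hge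
    have hge2 : (n : ℝ) ^ ((b : ℝ) + 1) ≤ (n : ℝ) ^ ((d : ℝ) ^ δ) :=
      Real.rpow_le_rpow_of_exponent_le hnR1 hbδ
    have heq : (n : ℝ) ^ ((b : ℝ) + 1) = (n : ℝ) ^ b * n := by
      rw [Real.rpow_add (by linarith), Real.rpow_natCast, Real.rpow_one]
    have hcast : ((n ^ b : ℕ) : ℝ) = (n : ℝ) ^ b := by push_cast; ring
    rw [hcast] at hfin
    have hpos : (0 : ℝ) < (n : ℝ) ^ b := by positivity
    nlinarith
  exact not_isSuccinctHittingSet_productDepth k pos hd1 hdn h10 hover e hnum ha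

/-- **The `∃ a ∀ b` shape (the quantifier order of crux `DefinableEquations`) on the constant
product-depth slice**: ONE level, `a = 1`, serves every size exponent `b` and every product-depth
`Δ ≥ 1`. [cite: LimayeSrinivasanTavenas2025, Cor. 4] -/
theorem naturalProofsAgainstProductDepth_uniform :
    ∃ a : ℕ, ∀ b Δ : ℕ, 1 ≤ Δ → ∃ n₀ : ℕ, ∀ n ≥ n₀, ¬ IsSuccinctHittingSet (degLEMonomials n)
      {f : MvPolynomial (Fin n) ℂ | f.totalDegree ≤ n ∧
        ∃ P : ArithCircuit ℂ (Fin n), P.Computes f ∧ P.size ≤ n ^ b ∧ P.productDepth ≤ Δ}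
      (Distinguishers ℂ n a) :=
  ⟨1, fun b Δ hΔ => naturalProofsAgainstProductDepth_levelOne b Δ hΔ⟩

/-- **`q = 0` Boolean-sum rendering of the uniform form**: one level `a = 1` such that for every
`b` and `Δ ≥ 1`, eventually in `n`, a datum `H` with `L(H), deg H ≤ C(2n,n)` and `boolSum H ≠ 0`
vanishes at `coeff(f)` for every `f` of degree `≤ n` with a product-depth-`Δ` circuit of `≤ n^b`
gates — `DefinableEquations` with `SmallCircuits ℂ n b` replaced by its constant-product-depth
slices. [cite: LimayeSrinivasanTavenas2025, Cor. 4] [cite: ForbesShpilkaVolk2018, Def. 1] -/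
theorem productDepthSliceEquations_uniform :
    ∃ a : ℕ, ∀ b Δ : ℕ, 1 ≤ Δ → ∃ n₀ : ℕ, ∀ n ≥ n₀, ∃ q : ℕ, q ≤ Nat.choose (2 * n) n ^ a ∧
      ∃ H : MvPolynomial (↥(degLEMonomials n) ⊕ Fin q) ℂ,
        complexity H ≤ Nat.choose (2 * n) n ^ a ∧ H.totalDegree ≤ Nat.choose (2 * n) n ^ a ∧
        boolSum H ≠ 0 ∧
        ∀ f : MvPolynomial (Fin n) ℂ, f.totalDegree ≤ n →
          (∃ P : ArithCircuit ℂ (Fin n), P.Computes f ∧ P.size ≤ n ^ b ∧ P.productDepth ≤ Δ) →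
          eval (coeffVector (degLEMonomials n) f) (boolSum H) = 0 := by
  refine ⟨1, fun b Δ hΔ => ?_⟩
  obtain ⟨n₀, h⟩ := naturalProofsAgainstProductDepth_levelOne b Δ hΔ
  refine ⟨n₀, fun n hn => ?_⟩
  obtain ⟨D, hD, hD0, hvan⟩ := (exists_isNaturalProof_iff _ _ _).mpr (h n hn)
  have hbs : boolSum (m := 0) (MvPolynomial.rename Sum.inl D) = D := by
    rw [boolSum, Fintype.sum_unique, MvPolynomial.aeval_rename, Sum.elim_comp_inl,
      MvPolynomial.aeval_X_left, AlgHom.coe_id, id_eq]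
  refine ⟨0, Nat.zero_le _, MvPolynomial.rename Sum.inl D, ?_, ?_, ?_, fun f hf hP => ?_⟩
  · exact (complexity_rename_le_holds' _ _).trans hD.1
  · exact (MvPolynomial.totalDegree_rename_le _ _).trans hD.2
  · rwa [hbs]
  · rw [hbs]; exact hvan f ⟨hf, hP⟩

end LSTSlice

end Summit.ValiantsHypothesis.ValiantsHypothesis.Theorems.BarrierLeverDefinableEquations
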